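import Summits.NavierStokesRegularity.FluidComputer.PalasekTowerStrainDoorAt
import Literature.Analysis.FluidPDE.ClassicalSolutionRescale

/-!
# The level-`1` mechanism door in ARBITRARY UNITS: free start time, centre, speed scale and viscosity

Cell `ns-blowup`, seat `ns-blowup-ecbridge-3` (g12; D-0074 GROUP C «BRIDGE SUPPORT», lineage `host_preparation`).
Route `PalasekTowerBreakdown`, crux stmt-NavierStokesRegularity-20303 `EpisodeBaseT = EpisodeBaseGAt TowerRates.tuned`
(line `straindoor`, whose first stub `StrainDoor.MechanismDoorAt TowerRates.tuned` is the tree theorem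
`Theorems.palasekTowerBreakdown_mechanismDoorAt_tuned`, p540639). LABEL: E–C typing (KERNEL: theorems only).
WHAT THIS IS NOT: not Navier–Stokes evidence — no run of any window is exhibited; `EpisodeBaseGAt R` appears only as
the conclusion of a conditional whose first hypothesis is the door itself; nothing about `RungG 1` or blow-up is
asserted.

## The point

The mechanism door `StrainDoor.MechanismDoorAt R` is stated in REGISTER units: viscosity `1`, datum speed `< Y₀(R)`,
the free run on the clock `[1, τfirstAt R]` (`τfirstAt R = 1 + wfirstAt R`, `wfirstAt R = 4bβ log N₁ / A₀`), the three
level-`1` faces at the numbers `Y₁(R)`, `A₁(R)`, `N₁(R)^{β−2}` on an `N₁(R)`-core loop. A computation (or a certificate)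
naturally lives in OTHER units — some viscosity `ν' > 0`, some start time `t_a`, some centre `x₀`, speeds of order one.
By the space–time scaling covariance of classical solutions (Literature
`IsClassicalNSSolutionOn.stRescale`: `(s, y) ↦ κ v(t₀ + κ²ν' s, x₀ + κν' y)` solves the system with viscosity `1` when
`v` solves it with viscosity `ν'`) the door pulls back to those units. **The dictionary** (speed conversion factor
`κ > 0`: register speed = `κ ×` kit speed; then register length `ℓ` = kit length `κν' ℓ`, register time `s` = kit
time `κ²ν' s`, register gradient = `κ²ν' ×` kit gradient, register circulation = kit circulation `/ ν'`):

* the kit window is `[t_a, t_a + T]` with `T = κ² ν' · wfirstAt R` — ANY start time `t_a`;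
* the kit datum `v t_a` is compactly supported (in `B̄(x₀, ρ)`, ANY centre) with `κ ‖v t_a x‖ < Y₀(R)` everywhere —
  ANY amplitude normalisation `κ` below `Y₀ / sup ‖v t_a‖`;
* cap `κ ‖v‖ ≤ (5/3) Y₁(R) − η` on the window; at `t_a + T`, inside `B̄(x₀, ρ)`: speed `κ ‖v‖ ≥ Y₁(R) + η`, gradient
  `κ²ν' ‖Dv‖ ≥ A₁(R) + η`, and a `C¹` loop inside a ball of radius `κν'/N₁(R)` with speed `≤ 8π κν'/N₁(R)` and
  circulation `≥ ν' (N₁(R)^{β−2} + η)`.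

`MechanismDoorAt.episodeBaseGAt_of_scaledFreeRun`: under `MechanismDoorAt R`, such a kit run gives `EpisodeBaseGAt R`.
No level-`0` face, no anchor, no pre-history and no far-field clause is asked of the kit run (the host is prepared by
the force inside the door); the START `t_a` of the free window is the designer's release time, not a first hitting time.
At `R = tuned` with the cell's kit normalisation (`Y₀ = A₀ = 1`, `ν' = N₀^{2−β} ≈ 1/776`, `κ = Y₀(tuned)/m` for a datum of
kit speed `< m`): window `169.85/m²`, thresholds `2.0705 m` (speed), `3.482 m²` (gradient), `1.231` inside radius
`0.5946/m` (core), cap `3.45 m` — the reading used in the seat's evidence note `DOOR-REREAD-T0.md` (20303 evidence #43).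

References: J. Leray, Acta Math. 63 (1934) §20 [cite: Leray1934, §20]; G. Koch, N. Nadirashvili, G. Seregin,
V. Šverák, Acta Math. 203 (2009) §6 (6.2) [cite: KochNadirashviliSereginSverak2009, §6 (6.2)]; S. Palasek,
arXiv:2605.13827 §4 [cite: Palasek2026ElementaryModel, §4].
-/

noncomputable section

namespace Summit.NavierStokesRegularity.FluidComputer.PalasekTowerClayBridge.StrainDoor

open Set MeasureTheory Metric Function
open scoped ENNReal NNReal ContDiff RealInnerProductSpace
open Literature.Analysis Literature.Analysis.FluidPDE

/-! ## §1 Bookkeeping for the affine clock `r ↦ (t_a − β) + β r` and the dilation `y ↦ x₀ + γ y` -/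

/-- The clock `r ↦ (t_a − β) + β r` (`β > 0`) pulls the kit window `[t_a, t_a + β w]` back to the register window
`[1, 1 + w]`. [folklore] -/
theorem preimage_clock_Icc {t_a β w : ℝ} (hβ : 0 < β) :
    (fun r => (t_a - β) + β * r) ⁻¹' Icc t_a (t_a + β * w) = Icc 1 (1 + w) := by
  ext r
  simp only [mem_preimage, mem_Icc]
  constructor
  · rintro ⟨h1, h2⟩
    exact ⟨by nlinarith, by nlinarith⟩
  · rintro ⟨h1, h2⟩
    exact ⟨by nlinarith, by nlinarith⟩

/-- Membership form of `preimage_clock_Icc`. [folklore] -/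
theorem clock_mem_Icc {t_a β w : ℝ} (hβ : 0 < β) {s : ℝ} (hs : s ∈ Icc 1 (1 + w)) :
    (t_a - β) + β * s ∈ Icc t_a (t_a + β * w) := by
  have h : s ∈ (fun r => (t_a - β) + β * r) ⁻¹' Icc t_a (t_a + β * w) := by
    rw [preimage_clock_Icc hβ]; exact hs
  exact h

/-- **Energy of a rescaled slice** (general amplitude `α`, dilation `γ > 0`, centre `x₀`):
`∫ ‖α u(t, x₀ + γ y)‖² dy = α² (γ³)⁻¹ ∫ ‖u(t, x)‖² dx`, in inequality form (`lintegral_comp_space_affine`). [folklore] -/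
theorem lintegral_enorm_sq_smul_stPull_le_of_le {α γ : ℝ} (hγ : 0 < γ) (β t₀ : ℝ) (x₀ : EuclideanSpace ℝ (Fin 3))
    (u : ℝ → EuclideanSpace ℝ (Fin 3) → EuclideanSpace ℝ (Fin 3)) (s : ℝ) {C : ℝ≥0∞}
    (hC : ∫⁻ x, ‖u (t₀ + β * s) x‖ₑ ^ 2 ≤ C) :
    ∫⁻ y, ‖(α • stPull β γ t₀ x₀ u) s y‖ₑ ^ 2 ≤
      ‖α‖ₑ ^ 2 * (ENNReal.ofReal (γ ^ Module.finrank ℝ (EuclideanSpace ℝ (Fin 3)))⁻¹ * C) := by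
  have h1 : ∀ y, ‖(α • stPull β γ t₀ x₀ u) s y‖ₑ ^ 2 =
      ‖α‖ₑ ^ 2 * ‖u (t₀ + β * s) (x₀ + γ • y)‖ₑ ^ 2 := by
    intro y
    rw [smul_stPull_apply, enorm_smul, mul_pow]
  simp_rw [h1]
  rw [lintegral_const_mul' _ _ (by simp)]
  gcongr
  rw [lintegral_comp_space_affine hγ x₀ (fun x => ‖u (t₀ + β * s) x‖ₑ ^ 2)]
  gcongr

/-- **Circulation under the affine change of loop**: for the rescaled slice `y ↦ α u(x₀ + γ y)` and the pulled-back
loop `s ↦ γ⁻¹ (c s − x₀)` (`γ ≠ 0`), `∮ = (α/γ) ∮_c u` (unconditional: both sides carry the same junk values). [folklore] -/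
theorem circulation_smul_affine_pullback {α γ : ℝ} (hγ : γ ≠ 0) (x₀ : EuclideanSpace ℝ (Fin 3))
    (V : EuclideanSpace ℝ (Fin 3) → EuclideanSpace ℝ (Fin 3)) (c : ℝ → EuclideanSpace ℝ (Fin 3)) :
    circulation (fun y => α • V (x₀ + γ • y)) (fun s => γ⁻¹ • (c s - x₀)) = α / γ * circulation V c := by
  unfold circulation
  rw [← intervalIntegral.integral_const_mul]
  refine intervalIntegral.integral_congr fun s _ => ?_
  have hderiv : deriv (fun s => γ⁻¹ • (c s - x₀)) s = γ⁻¹ • deriv c s := by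
    rw [deriv_fun_const_smul_field, deriv_sub_const]
  simp only [hderiv, smul_smul, mul_inv_cancel₀ hγ, one_smul, add_sub_cancel, real_inner_smul_left,
    real_inner_smul_right]
  ring

/-! ## §2 The door in arbitrary units -/

/-- **THE LEVEL-`1` MECHANISM DOOR IN ARBITRARY UNITS** (free start time `t_a`, centre `x₀`, speed conversion `κ > 0`,
viscosity `ν' > 0`). Assume the door `MechanismDoorAt R`. Let `(v, q)` be a classical FREE Navier–Stokes run with
viscosity `ν'` on the kit window `[t_a, t_a + T]`, `T = κ² ν' · wfirstAt R`, whose first slice `v t_a` is supported in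
`B̄(x₀, ρ)` (`ρ ≥ 0`) with `κ ‖v t_a x‖ < Y₀(R)` for every `x`, with finite energy on the window, under the cap
`κ ‖v t x‖ ≤ (5/3) Y₁(R) − η` (`η > 0`), and showing at `t_a + T`, at points of `B̄(x₀, ρ)`: `Y₁(R) + η ≤ κ ‖v‖`,
`A₁(R) + η ≤ κ²ν' ‖Dv‖`, and a `C¹` closed loop inside a ball of radius `κν'/N₁(R)` with speed `≤ 8π κν'/N₁(R)` and
circulation `≥ ν' (N₁(R)^{β−2} + η)`. Then `EpisodeBaseGAt R`. Proof: the rescaled pair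
`(s, y) ↦ κ v((t_a − κ²ν') + κ²ν' s, x₀ + κν' y)`, `κ² q(…)` is a classical free run with viscosity `1` on
`[1, τfirstAt R]` (`IsClassicalNSSolutionOn.stRescale`), and every hypothesis of the door is the corresponding kit
hypothesis read through the dictionary (`fderiv_stPull`, `lintegral_comp_space_affine`, the affine change of loop).
[cite: Leray1934, §20] [cite: Palasek2026ElementaryModel, §4] -/
theorem MechanismDoorAt.episodeBaseGAt_of_scaledFreeRun {R : TowerRates} (hD : MechanismDoorAt R)
    {ν' κ : ℝ} (hν' : 0 < ν') (hκ : 0 < κ) (t_a : ℝ) (x₀ : EuclideanSpace ℝ (Fin 3)) {T : ℝ}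
    (hT : T = κ ^ 2 * ν' * Host.wfirstAt R)
    {v : ℝ → EuclideanSpace ℝ (Fin 3) → EuclideanSpace ℝ (Fin 3)} {q : ℝ → EuclideanSpace ℝ (Fin 3) → ℝ}
    (hv : IsClassicalNSSolutionOn (Icc t_a (t_a + T)) ν' 0 v q)
    {ρ : ℝ} (hρ : 0 ≤ ρ) (hsupp : tsupport (v t_a) ⊆ closedBall x₀ ρ)
    (hlt : ∀ x, κ * ‖v t_a x‖ < R.Y 0)
    (hE : ∃ C : ℝ≥0∞, C < ⊤ ∧ ∀ t ∈ Icc t_a (t_a + T), ∫⁻ x, ‖v t x‖ₑ ^ 2 ≤ C)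
    {η : ℝ} (hη : 0 < η)
    (hcap : ∀ t ∈ Icc t_a (t_a + T), ∀ x, κ * ‖v t x‖ ≤ 5 / 3 * R.Y 1 - η)
    (hspeed : ∃ x, ‖x - x₀‖ ≤ ρ ∧ R.Y 1 + η ≤ κ * ‖v (t_a + T) x‖)
    (hstrain : ∃ x, ‖x - x₀‖ ≤ ρ ∧ R.A 1 + η ≤ κ ^ 2 * ν' * ‖fderiv ℝ (v (t_a + T)) x‖)
    (hcore : ∃ (x : EuclideanSpace ℝ (Fin 3)) (c : ℝ → EuclideanSpace ℝ (Fin 3)),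
      ‖x - x₀‖ ≤ ρ ∧ ContDiff ℝ 1 c ∧ c 0 = c 1 ∧
      (∀ s ∈ Icc (0 : ℝ) 1, c s ∈ closedBall x (κ * ν' / R.N 1)) ∧
      (∀ s ∈ Icc (0 : ℝ) 1, ‖deriv c s‖ ≤ 8 * Real.pi * (κ * ν') / R.N 1) ∧
      ν' * (R.N 1 ^ (R.β - 2) + η) ≤ circulation (v (t_a + T)) c) :
    EpisodeBaseGAt R := by
  -- the parameters of the rescaling: dilation `g = κ ν'`, clock rate `b = κ g = κ² ν'`, clock origin `t₀ = t_a − b`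
  set g : ℝ := κ * ν' with hg
  have hgpos : 0 < g := mul_pos hκ hν'
  have hg0 : g ≠ 0 := hgpos.ne'
  set b : ℝ := κ * g with hb
  have hbpos : 0 < b := mul_pos hκ hgpos
  have hb2 : κ ^ 2 * ν' = b := by rw [hb, hg]; ring
  have hTb : T = b * Host.wfirstAt R := by rw [hT, hb2]
  set t₀ : ℝ := t_a - b with ht₀
  have hN1 : 0 < R.N 1 := R.N_pos 1
  -- the clock: `t₀ + b · 1 = t_a`, `t₀ + b · τfirstAt R = t_a + T`, `[1, τfirstAt R] ↦ [t_a, t_a + T]`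
  have hclock1 : t₀ + b * 1 = t_a := by rw [ht₀]; ring
  have hclockT : t₀ + b * Host.τfirstAt R = t_a + T := by rw [Host.τfirstAt_eq, hTb, ht₀]; ring
  have hS : (fun r => t₀ + b * r) ⁻¹' Icc t_a (t_a + T) = Icc 1 (Host.τfirstAt R) := by
    rw [Host.τfirstAt_eq, hTb, ht₀]
    exact preimage_clock_Icc hbpos
  have hmem : ∀ {s : ℝ}, s ∈ Icc 1 (Host.τfirstAt R) → t₀ + b * s ∈ Icc t_a (t_a + T) := by
    intro s hs
    have h := clock_mem_Icc (t_a := t_a) (w := Host.wfirstAt R) hbpos (s := s)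
      (by rw [← Host.τfirstAt_eq]; exact hs)
    rw [hTb, ht₀]
    exact h
  have h1mem : (1 : ℝ) ∈ Icc 1 (Host.τfirstAt R) := ⟨le_rfl, (Host.one_lt_τfirstAt R).le⟩
  have hτmem : Host.τfirstAt R ∈ Icc 1 (Host.τfirstAt R) := ⟨(Host.one_lt_τfirstAt R).le, le_rfl⟩
  -- the rescaled classical free run with viscosity `1` on `[1, τfirstAt R]`
  have key : IsClassicalNSSolutionOn (Icc 1 (Host.τfirstAt R)) 1 0 (κ • stPull b g t₀ x₀ v)
      (κ ^ 2 • stPull b g t₀ x₀ q) := by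
    have h := hv.stRescale hκ hgpos hb t₀ x₀
    rw [hS, smul_stPull_zero, show κ * ν' / g = 1 from by rw [hg]; exact div_self hg0] at h
    exact h
  -- the datum `W = κ v(t_a, x₀ + g ·)`: smooth, divergence free, supported in `B̄(0, ρ/g)`, speed `< Y₀`
  have hW1 : (κ • stPull b g t₀ x₀ v) 1 = fun y => κ • v t_a (x₀ + g • y) := by
    funext y
    rw [smul_stPull_apply, hclock1]
  have hWsmooth : ContDiff ℝ ∞ ((κ • stPull b g t₀ x₀ v) 1) := key.contDiff_velocity h1mem
  have hWdiv : VectorCalculus.IsDivFree ((κ • stPull b g t₀ x₀ v) 1) := key.divFree 1 h1mem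
  have hWsupp : tsupport ((κ • stPull b g t₀ x₀ v) 1) ⊆ closedBall 0 (ρ / g) := by
    rw [hW1]
    refine closure_minimal (fun y hy => ?_) isClosed_closedBall
    have hy' : v t_a (x₀ + g • y) ≠ 0 := by
      intro h0
      exact hy (by simp [h0])
    have hmemsupp : x₀ + g • y ∈ closedBall x₀ ρ := hsupp (subset_tsupport _ hy')
    rw [mem_closedBall, dist_eq_norm, add_sub_cancel_left, norm_smul, Real.norm_of_nonneg hgpos.le] at hmemsupp
    rw [mem_closedBall, dist_zero_right, le_div_iff₀ hgpos, mul_comm]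
    exact hmemsupp
  have hWlt : ∀ y, ‖(κ • stPull b g t₀ x₀ v) 1 y‖ < R.Y 0 := by
    intro y
    rw [hW1]
    dsimp only
    rw [norm_smul, Real.norm_of_nonneg hκ.le]
    exact hlt _
  have hρ' : 0 ≤ ρ / g := div_nonneg hρ hgpos.le
  -- energy on the register window
  have hE' : ∃ C : ℝ≥0∞, C < ⊤ ∧ ∀ s ∈ Icc (1 : ℝ) (Host.τfirstAt R),
      ∫⁻ y, ‖(κ • stPull b g t₀ x₀ v) s y‖ₑ ^ 2 ≤ C := by
    obtain ⟨C, hC, hCb⟩ := hE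
    refine ⟨‖κ‖ₑ ^ 2 * (ENNReal.ofReal (g ^ Module.finrank ℝ (EuclideanSpace ℝ (Fin 3)))⁻¹ * C), ?_, ?_⟩
    · exact ENNReal.mul_lt_top (by simp) (ENNReal.mul_lt_top ENNReal.ofReal_lt_top hC)
    · intro s hs
      exact lintegral_enorm_sq_smul_stPull_le_of_le hgpos b t₀ x₀ v s (hCb _ (hmem hs))
  -- cap on the register window
  have hcap' : ∀ s ∈ Icc (1 : ℝ) (Host.τfirstAt R), ∀ y,
      ‖(κ • stPull b g t₀ x₀ v) s y‖ ≤ 5 / 3 * R.Y 1 - η := by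
    intro s hs y
    rw [smul_stPull_apply, norm_smul, Real.norm_of_nonneg hκ.le]
    exact hcap _ (hmem hs) _
  -- the readout slice at `τfirstAt R` is `κ v(t_a + T, x₀ + g ·)`
  have hWT : (κ • stPull b g t₀ x₀ v) (Host.τfirstAt R) = fun y => κ • v (t_a + T) (x₀ + g • y) := by
    funext y
    rw [smul_stPull_apply, hclockT]
  -- the pulled-back readout point `y = g⁻¹ (x − x₀)` of a kit point `x ∈ B̄(x₀, ρ)`
  have hpt : ∀ {x : EuclideanSpace ℝ (Fin 3)}, ‖x - x₀‖ ≤ ρ →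
      ‖g⁻¹ • (x - x₀)‖ ≤ ρ / g ∧ x₀ + g • (g⁻¹ • (x - x₀)) = x := by
    intro x hx
    refine ⟨?_, ?_⟩
    · rw [norm_smul, Real.norm_of_nonneg (inv_nonneg.2 hgpos.le), inv_mul_eq_div]
      exact div_le_div_of_nonneg_right hx hgpos.le
    · rw [smul_smul, mul_inv_cancel₀ hg0, one_smul, add_sub_cancel]
  -- speed face
  have hspeed' : ∃ y, ‖y‖ ≤ ρ / g ∧ R.Y 1 + η ≤ ‖(κ • stPull b g t₀ x₀ v) (Host.τfirstAt R) y‖ := by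
    obtain ⟨x, hx, hfl⟩ := hspeed
    refine ⟨g⁻¹ • (x - x₀), (hpt hx).1, ?_⟩
    rw [hWT]
    dsimp only
    rw [(hpt hx).2, norm_smul, Real.norm_of_nonneg hκ.le]
    exact hfl
  -- gradient face
  have hstrain' : ∃ y, ‖y‖ ≤ ρ / g ∧
      R.A 1 + η ≤ ‖fderiv ℝ ((κ • stPull b g t₀ x₀ v) (Host.τfirstAt R)) y‖ := by
    obtain ⟨x, hx, hfl⟩ := hstrain
    refine ⟨g⁻¹ • (x - x₀), (hpt hx).1, ?_⟩
    have hdiff : Differentiable ℝ (v (t₀ + b * Host.τfirstAt R)) := by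
      rw [hclockT]
      exact (hv.contDiff_velocity (hclockT ▸ hmem hτmem)).differentiable (by simp)
    have hd : DifferentiableAt ℝ (stPull b g t₀ x₀ v (Host.τfirstAt R)) (g⁻¹ • (x - x₀)) :=
      differentiable_stPull_slice hdiff _
    have hfd : fderiv ℝ ((κ • stPull b g t₀ x₀ v) (Host.τfirstAt R)) (g⁻¹ • (x - x₀)) =
        κ • (g • fderiv ℝ (v (t_a + T)) x) := by
      rw [show (κ • stPull b g t₀ x₀ v) (Host.τfirstAt R) = κ • (stPull b g t₀ x₀ v (Host.τfirstAt R)) from rfl,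
        fderiv_const_smul hd, fderiv_stPull, hclockT, (hpt hx).2]
    rw [hfd, norm_smul, norm_smul, Real.norm_of_nonneg hκ.le, Real.norm_of_nonneg hgpos.le, ← mul_assoc,
      show κ * g = κ ^ 2 * ν' from by rw [hg]; ring]
    exact hfl
  -- core face: the pulled-back loop `s ↦ g⁻¹ (c s − x₀)`
  have hcore' : ∃ (y : EuclideanSpace ℝ (Fin 3)) (γ : ℝ → EuclideanSpace ℝ (Fin 3)),
      ‖y‖ ≤ ρ / g ∧ ContDiff ℝ 1 γ ∧ γ 0 = γ 1 ∧
      (∀ s ∈ Icc (0 : ℝ) 1, γ s ∈ closedBall y (1 / R.N 1)) ∧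
      (∀ s ∈ Icc (0 : ℝ) 1, ‖deriv γ s‖ ≤ 8 * Real.pi / R.N 1) ∧
      R.N 1 ^ (R.β - 2) + η ≤ circulation ((κ • stPull b g t₀ x₀ v) (Host.τfirstAt R)) γ := by
    obtain ⟨x, c, hx, hc1, hc01, hball, hspd, hcirc⟩ := hcore
    refine ⟨g⁻¹ • (x - x₀), fun s => g⁻¹ • (c s - x₀), (hpt hx).1, ?_, ?_, ?_, ?_, ?_⟩
    · exact (hc1.sub contDiff_const).const_smul _
    · simp only [hc01]
    · intro s hs
      have h := hball s hs
      rw [mem_closedBall, dist_eq_norm] at h ⊢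
      rw [← smul_sub, sub_sub_sub_cancel_right, norm_smul, Real.norm_of_nonneg (inv_nonneg.2 hgpos.le)]
      calc g⁻¹ * ‖c s - x‖ ≤ g⁻¹ * (κ * ν' / R.N 1) := mul_le_mul_of_nonneg_left h (inv_nonneg.2 hgpos.le)
        _ = 1 / R.N 1 := by rw [← hg]; field_simp
    · intro s hs
      have h := hspd s hs
      rw [deriv_fun_const_smul_field, deriv_sub_const, norm_smul, Real.norm_of_nonneg (inv_nonneg.2 hgpos.le)]
      calc g⁻¹ * ‖deriv c s‖ ≤ g⁻¹ * (8 * Real.pi * (κ * ν') / R.N 1) :=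
            mul_le_mul_of_nonneg_left h (inv_nonneg.2 hgpos.le)
        _ = 8 * Real.pi / R.N 1 := by rw [← hg]; field_simp
    · rw [hWT, circulation_smul_affine_pullback hg0 x₀ (v (t_a + T)) c,
        show κ / g = ν'⁻¹ from by rw [hg, ← div_div, div_self hκ.ne', one_div]]
      rw [inv_mul_eq_div, le_div_iff₀ hν', mul_comm]
      exact hcirc
  -- close by the door
  exact hD hWsmooth hWdiv hWsupp hWlt hρ' key rfl hE' hη hcap' hspeed' hstrain' hcore'

end Summit.NavierStokesRegularity.FluidComputer.PalasekTowerClayBridge.StrainDoor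

end
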